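import Summits.HodgeConjecture.HodgeConjecture.Theorems.Ring2AbelianAllSpreadPowPrimitive
import Literature.AlgebraicGeometry.Motives.AbelianVarietyCohomologyExteriorH1
import HarnessLib

/-!
# Ring 2 · AbelianAll · SPREADING, part XXI — the diagonal lift `Φ : H^{a+1}(A) → H^{a+1}(A^{a+1})`:
a linear section of `Δ^*` with PRIMITIVE values (third instalment of R2′ toward `(PL)`, fact-free)

research route, not a corollary; conditional on HC_CM plus one named minimal statement.
(Cell line: research route conditional on HC_CM; not a corollary; Q11.4-sentence-2 already refuted in dim ≥ 3.)

HONEST FRAMING (page 1). Research route, not a corollary: the target of this line is HC for all complex abelian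
varieties CONDITIONAL on `HC_CM` (`Summit…Theses.RankFourFaces.CMAbelianHodge`, a hypothesis) plus ONE named
minimal statement `B_min`; the `B_min` of record is unchanged by this file (least typed node N103
`EvenPrimitiveHodgeFailureSpreadsToCMFibre`, part XVI; "minimal" is claimed nowhere). This file proves, with no new
`def`, no `sorry` and no new named fact, the EXISTENCE of the lift of the seat's `SPREAD.md` §36 `(PL-Δ)`:
for a complex abelian variety `A` with `dim A ≥ 1` and every `a`, a `ℂ`-linear map
`Φ : H^{a+1}(A) → H^{a+1}(A^{a+1})` and a hard-Lefschetz datum `Λ` of `A^{a+1}` with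
  (1) `Δ^* ∘ Φ = id` for the `(a+1)`-fold diagonal `Δ = (𝟙, …, 𝟙) : A ⟶ A^{a+1}`;
  (2) `Φ x` is `Λ`-PRIMITIVE for EVERY `x ∈ H^{a+1}(A)`;
  (3) on monomials `Φ (v₀ ⌣ ⋯ ⌣ v_a) = ((a+1)!)⁻¹ ∑_σ sgn σ · pr₀^* v_{σ 0} ⌣ ⋯ ⌣ pr_a^* v_{σ a}` (the antisymmetrised
      external product).
Construction: `H•(A) = ⋀• H¹(A)` (`Motives.AbelianVariety.hasExteriorCohomologyH1_complexPoints`, a theorem of the tree),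
so `Φ := Ψ ∘ (⋀^{a+1} H¹(A) ≃ H^{a+1}(A))⁻¹` with `Ψ` induced (`exteriorPower.alternatingMapLinearEquiv`) by the alternating
map `((a+1)!)⁻¹ · Alt(ext)`, `ext(v) = pr₀^* v₀ ⌣ ⋯ ⌣ pr_a^* v_a` (`MultilinearMap.alternatization`); (1) is
`Δ^* ∘ ext = (v ↦ v₀ ⌣ ⋯ ⌣ v_a)` (part XX `map_diagonal_cupPowOne_powProj`) and `Alt` of an already alternating map is
`(a+1)!` times it (`AlternatingMap.coe_alternatization`); (2) is part XX
`exists_hardLefschetzNFold_powSucc_cupPowOne_mem_primitiveClasses` (every external product of degree-one classes is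
`Λ`-primitive) and linearity. NOT proved here: that `Φ` preserves rationality and Hodge type `(p, p)` (parts to come),
hence nothing yet about `(PL)` or the nodes N1 / N102 / N103.
[cite: Andre1996Motifs, §1.3 (p. 12)] [cite: HatcherAT2002, §3.2 Prop. 3.10 and Example 3.16]
[cite: VoisinHodgeI2002, §6.2.3 Def. 6.24 and Thm. 6.25] [cite: LangeBirkenhake1992, §1.4 Thm. 1.4.1]
-/

noncomputable section

set_option linter.dupNamespace false

open CategoryTheory
open Literature.AlgebraicTopology.SingularHomology Literature.Geometry.Kaehler
open Literature.AlgebraicGeometry Literature.AlgebraicGeometry.HodgeTheory Literature.AlgebraicGeometry.Motives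
open Literature.AlgebraicGeometry.Milne1999

namespace Summit.HodgeConjecture.HodgeConjecture.Ring2.AbelianAll

/-- **The diagonal lift (existence).** For a complex abelian variety `A` of positive dimension and every `a` there are a
hard-Lefschetz datum `Λ` of `A^{a+1}` and a `ℂ`-linear map `Φ : H^{a+1}(A) → H^{a+1}(A^{a+1})` with: `Δ^* (Φ x) = x`
for the diagonal `Δ = (𝟙, …, 𝟙)`; `Φ x` is `Λ`-primitive for every `x`; and
`Φ (v₀ ⌣ ⋯ ⌣ v_a) = ((a+1)!)⁻¹ ∑_σ sgn σ · pr₀^* v_{σ 0} ⌣ ⋯ ⌣ pr_a^* v_{σ a}`.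
[cite: Andre1996Motifs, §1.3 (p. 12)] [cite: HatcherAT2002, §3.2 Prop. 3.10 and Example 3.16]
[cite: LangeBirkenhake1992, §1.4 Thm. 1.4.1] -/
theorem exists_diagonalLift (A : AbelianVariety ℂ) (hA : 1 ≤ A.dim) (a : ℕ) :
    ∃ (Λ : HardLefschetzNFold (A.powSucc a).dim (A.powSucc a).X)
      (Φ : complexBetti A.X (a + 1) →ₗ[ℂ] complexBetti (A.powSucc a).X (a + 1)),
      (∀ x, complexBetti.map (powLift a fun _ : Fin (a + 1) ↦ 𝟙 A).hom.hom.hom (a + 1) (Φ x) = x) ∧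
      (∀ x, Φ x ∈ primitiveClasses Λ.hyperplaneClass (A.powSucc a).dim (a + 1)) ∧
      (∀ v : Fin (a + 1) → complexBetti A.X 1,
        Φ (cupPowOne ℂ (Motives.ComplexPoints A.X) (a + 1) v) =
          ((a + 1).factorial : ℂ)⁻¹ • ∑ σ : Equiv.Perm (Fin (a + 1)),
            ((Equiv.Perm.sign σ : ℤ) : ℂ) • cupPowOne ℂ (Motives.ComplexPoints (A.powSucc a).X) (a + 1)
              (fun i ↦ complexBetti.map (powProj A a i).hom.hom.hom 1 (v (σ i)))) := by
  classical
  obtain ⟨Λ, hΛ⟩ := exists_hardLefschetzNFold_powSucc_cupPowOne_mem_primitiveClasses A hA a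
  have h : HasExteriorCohomologyH1 ℂ (Motives.ComplexPoints A.X) :=
    Motives.AbelianVariety.hasExteriorCohomologyH1_complexPoints A
  -- the factorial scalar
  have hc : ((a + 1).factorial : ℂ) ≠ 0 := Nat.cast_ne_zero.2 (Nat.factorial_ne_zero _)
  -- the external product `ext(v) = pr₀^* v₀ ⌣ ⋯ ⌣ pr_a^* v_a`, multilinear in `v`
  obtain ⟨ext, hext⟩ : ∃ ext : MultilinearMap ℂ (fun _ : Fin (a + 1) ↦ complexBetti A.X 1)
      (complexBetti (A.powSucc a).X (a + 1)),
      ∀ w, ext w = cupPowOne ℂ (Motives.ComplexPoints (A.powSucc a).X) (a + 1)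
        (fun i ↦ complexBetti.map (powProj A a i).hom.hom.hom 1 (w i)) :=
    ⟨(cupPowOne ℂ (Motives.ComplexPoints (A.powSucc a).X) (a + 1)).compLinearMap
        fun i ↦ (complexBetti.map (powProj A a i).hom.hom.hom 1).hom,
      fun w ↦ by rw [MultilinearMap.compLinearMap_apply]⟩
  -- the diagonal pull-back as a linear map
  obtain ⟨D, hD⟩ : ∃ D : complexBetti (A.powSucc a).X (a + 1) →ₗ[ℂ] complexBetti A.X (a + 1),
      ∀ y, D y = complexBetti.map (powLift a fun _ : Fin (a + 1) ↦ 𝟙 A).hom.hom.hom (a + 1) y :=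
    ⟨(complexBetti.map (powLift a fun _ : Fin (a + 1) ↦ 𝟙 A).hom.hom.hom (a + 1)).hom, fun _ ↦ rfl⟩
  -- `Δ^* ∘ ext = (v ↦ v₀ ⌣ ⋯ ⌣ v_a)` (part XX)
  have hDext : D.compMultilinearMap ext =
      (cupPowOneAlt ℂ (Motives.ComplexPoints A.X) (a + 1) : MultilinearMap ℂ _ _) := by
    ext w
    rw [LinearMap.compMultilinearMap_apply, hext, hD, AlternatingMap.coe_multilinearMap, cupPowOneAlt_apply]
    exact map_diagonal_cupPowOne_powProj A a w
  -- hence `Δ^* (Alt(ext) v) = (a+1)! · v₀ ⌣ ⋯ ⌣ v_a`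
  have hDalt : ∀ v, D (MultilinearMap.alternatization ext v) =
      ((a + 1).factorial : ℂ) • cupPowOne ℂ (Motives.ComplexPoints A.X) (a + 1) v := by
    intro v
    have key := congrArg (fun f : (complexBetti A.X 1) [⋀^Fin (a + 1)]→ₗ[ℂ] complexBetti A.X (a + 1) ↦ f v)
      (LinearMap.compMultilinearMap_alternatization D ext)
    simp only [LinearMap.compAlternatingMap_apply, hDext, AlternatingMap.coe_alternatization, Fintype.card_fin,
      AlternatingMap.smul_apply, cupPowOneAlt_apply] at key
    rw [← key, Nat.cast_smul_eq_nsmul]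
  -- the alternating lift and the linear maps `Ψ`, `Φ`
  set extAlt : (complexBetti A.X 1) [⋀^Fin (a + 1)]→ₗ[ℂ] complexBetti (A.powSucc a).X (a + 1) :=
    ((a + 1).factorial : ℂ)⁻¹ • MultilinearMap.alternatization ext with hextAlt
  set Ψ : ↥(⋀[ℂ]^(a + 1) (complexBetti A.X 1)) →ₗ[ℂ] complexBetti (A.powSucc a).X (a + 1) :=
    exteriorPower.alternatingMapLinearEquiv extAlt with hΨ
  set Φ : complexBetti A.X (a + 1) →ₗ[ℂ] complexBetti (A.powSucc a).X (a + 1) :=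
    Ψ ∘ₗ (h.equiv (a + 1)).symm.toLinearMap with hΦ
  -- (3) the monomial formula
  have hmono : ∀ v : Fin (a + 1) → complexBetti A.X 1,
      Φ (cupPowOne ℂ (Motives.ComplexPoints A.X) (a + 1) v) = extAlt v := by
    intro v
    have hsymm : (h.equiv (a + 1)).symm (cupPowOne ℂ (Motives.ComplexPoints A.X) (a + 1) v) =
        exteriorPower.ιMulti ℂ (a + 1) v := by
      rw [LinearEquiv.symm_apply_eq, HasExteriorCohomologyH1.equiv_apply, wedgeToCup_ιMulti]
    rw [hΦ, LinearMap.comp_apply, LinearEquiv.coe_toLinearMap, hsymm, hΨ,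
      exteriorPower.alternatingMapLinearEquiv_apply_ιMulti]
  have hextAlt_apply : ∀ v : Fin (a + 1) → complexBetti A.X 1,
      extAlt v = ((a + 1).factorial : ℂ)⁻¹ • ∑ σ : Equiv.Perm (Fin (a + 1)),
        ((Equiv.Perm.sign σ : ℤ) : ℂ) • cupPowOne ℂ (Motives.ComplexPoints (A.powSucc a).X) (a + 1)
          (fun i ↦ complexBetti.map (powProj A a i).hom.hom.hom 1 (v (σ i))) := by
    intro v
    rw [hextAlt, AlternatingMap.smul_apply, MultilinearMap.alternatization_apply]
    congr 1
    refine Finset.sum_congr rfl fun σ _ ↦ ?_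
    rw [MultilinearMap.domDomCongr_apply, hext, Units.smul_def, Int.cast_smul_eq_zsmul]
  -- (1) `Δ^* ∘ Φ = id`: check on `⋀^{a+1} H¹(A)` through the generators `ιMulti`
  have hDΨ : D ∘ₗ Ψ = wedgeToCup ℂ (Motives.ComplexPoints A.X) (a + 1) := by
    refine exteriorPower.linearMap_ext ?_
    ext v
    rw [LinearMap.compAlternatingMap_apply, LinearMap.compAlternatingMap_apply, LinearMap.comp_apply, hΨ,
      exteriorPower.alternatingMapLinearEquiv_apply_ιMulti, wedgeToCup_ιMulti, hextAlt, AlternatingMap.smul_apply,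
      map_smul, hDalt, inv_smul_smul₀ hc]
  have hsection : ∀ x, complexBetti.map (powLift a fun _ : Fin (a + 1) ↦ 𝟙 A).hom.hom.hom (a + 1) (Φ x) = x := by
    intro x
    rw [← hD, hΦ, LinearMap.comp_apply, ← LinearMap.comp_apply (f := D), hDΨ, LinearEquiv.coe_toLinearMap,
      ← HasExteriorCohomologyH1.equiv_apply h, LinearEquiv.apply_symm_apply]
  -- (2) primitivity of every value: `H^{a+1}(A)` is spanned by monomials, whose lifts are sums of primitive classes
  have hprim : ∀ x, Φ x ∈ primitiveClasses Λ.hyperplaneClass (A.powSucc a).dim (a + 1) := by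
    have hle : Submodule.span ℂ (Set.range (cupPowOne ℂ (Motives.ComplexPoints A.X) (a + 1))) ≤
        (primitiveClasses Λ.hyperplaneClass (A.powSucc a).dim (a + 1)).comap Φ := by
      refine Submodule.span_le.2 ?_
      rintro _ ⟨v, rfl⟩
      rw [SetLike.mem_coe, Submodule.mem_comap, hmono, hextAlt_apply]
      refine Submodule.smul_mem _ _ (Submodule.sum_mem _ fun σ _ ↦ Submodule.smul_mem _ _ ?_)
      exact hΛ fun i ↦ v (σ i)
    intro x
    have hx : x ∈ Submodule.span ℂ (Set.range (cupPowOne ℂ (Motives.ComplexPoints A.X) (a + 1))) := by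
      rw [h.span_range_cupPowOne]; exact Submodule.mem_top
    exact hle hx
  exact ⟨Λ, Φ, hsection, hprim, fun v ↦ (hmono v).trans (hextAlt_apply v)⟩

end Summit.HodgeConjecture.HodgeConjecture.Ring2.AbelianAll
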